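import Literature.NumberTheory.DiophantineGeometry.ConductorExponentLeFiveProofs
import HarnessLib

/-!
# Tate's algorithm at `p = 3`: exact valuations of `c₄, c₆, Δ` at the exits III*, II* (and I₀, Iₙ)

`Proofs` file (theorems only; no definition, no named fact) in topic
`NumberTheory/DiophantineGeometry`, third file of the kernel discharge of
`WeierstrassCurve.conductorExponent_eq_tableConductorExponentThree` (cell `b2b-bsdres`, team
n1011, ROW T-PAP3): the exits of Steps 9 and 10 of Silverman, *ATAEC* IV.9.4 over a discrete
valuation ring `R` with `2 ∈ Rˣ` and `3` a uniformiser, on a Step-9 normalised model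
(`π ∣ a₁`, `π² ∣ a₂`, `π³ ∣ a₃, a₄`, `π⁵ ∣ a₆`):

* `exitIIIstar_values` — `π⁴ ∤ a₄` (type III*): `ord Δ = 9` and either `3⁴ ∣ c₄`, `ord c₆ = 6`
  (Rizzo's row `(≥4,6,9)` with the special condition) or `ord c₄ = 4`, `3⁸ ∣ c₆`
  (row `(4,≥8,9)`) — the exit-III data shifted by `(2, 3, 6)`;
* `exitIIstar_values` — `π⁴ ∣ a₄`, `π⁶ ∤ a₆` (type II*): `(4,6,11)`, `(5,8,12)` or
  `(≥6,8,13)` — the exit-IV data shifted by `(2, 3, 6)`; the last two rows have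
  `v(c₄) ≥ 4, v(c₆) ≥ 6, v(Δ) ≥ 12` although the equation is minimal, and appear in Rizzo's
  table as the starred reduced triples `(1,2,0)`, `(≥2,2,1)`;
* `good_values`, `multiplicative_values` — Steps 1–2: `3 ∤ Δ` gives `(0,0,0)` or `(1,≥3,0)`
  (`3 ∣ c₄` forces `3 ∣ b₂`, `27 ∣ c₆`, and `1728Δ = c₄³ − c₆²` forces `ord c₄ = 1`); `3 ∣ Δ`,
  `3 ∤ c₄` gives `3 ∤ c₆` (rows `(0,0,n)`).

All parametrisations use the uniformiser `3` itself (`aᵢ = 3^{kᵢ}·xᵢ`), so that the identities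
are those of `TateAlgorithmThreeExitValuesProofs` multiplied by powers of `3`.

## References

* J. H. Silverman, *Advanced Topics in the Arithmetic of Elliptic Curves*, GTM 151 (1994), IV.9.4
  Steps 9–10 and Table 4.1. [Silverman1994]
* I. Papadopoulos, J. Number Theory 44 (1993) 119–152, §2 and Table III (`p = 3`). [Papadopoulos1993]
* O. G. Rizzo, Compositio Math. 136 (2003) 1–23, Table II (p. 4). [Rizzo2003]
-/

open Polynomial IsLocalRing
open IsDiscreteValuationRing hiding maximalIdeal

namespace Literature.NumberTheory.DiophantineGeometry

namespace TateAlgorithm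

variable {R : Type*} [CommRing R] [IsDomain R] [IsDiscreteValuationRing R]

omit [IsDomain R] [IsDiscreteValuationRing R] in
/-- Small units when `2 ∈ Rˣ`: `8 = 2³`. [folklore] -/
private theorem isUnit_eight'' (h2 : IsUnit (2 : R)) : IsUnit (8 : R) := by
  have : (8 : R) = 2 ^ 3 := by norm_num
  rw [this]; exact h2.pow 3

omit [IsDomain R] [IsDiscreteValuationRing R] in
/-- `c₄ = 3⁴(B₂² − 24B₄)` when `b₂ = 3²B₂`, `b₄ = 3⁴B₄`. [folklore] -/
private theorem c₄_of_b_nine_of_b₄ (W : WeierstrassCurve R) {B₂ B₄ : R} (hb₂ : W.b₂ = 3 ^ 2 * B₂)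
    (hb₄ : W.b₄ = 3 ^ 4 * B₄) : W.c₄ = 3 ^ 4 * (B₂ ^ 2 - 24 * B₄) := by
  simp only [WeierstrassCurve.c₄]; rw [hb₂, hb₄]; ring

omit [IsDomain R] [IsDiscreteValuationRing R] in
/-- `c₆ = 3⁶(−B₂³ + 36B₂B₄ − 72B₆)` when `b₂ = 3²B₂`, `b₄ = 3⁴B₄`, `b₆ = 3⁵B₆`. [folklore] -/
private theorem c₆_of_b_nine_of_b₄ (W : WeierstrassCurve R) {B₂ B₄ B₆ : R} (hb₂ : W.b₂ = 3 ^ 2 * B₂)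
    (hb₄ : W.b₄ = 3 ^ 4 * B₄) (hb₆ : W.b₆ = 3 ^ 5 * B₆) :
    W.c₆ = 3 ^ 6 * (-B₂ ^ 3 + 36 * B₂ * B₄ - 72 * B₆) := by
  simp only [WeierstrassCurve.c₆]; rw [hb₂, hb₄, hb₆]; ring

omit [IsDomain R] [IsDiscreteValuationRing R] in
/-- `4Δ = 3¹¹(−B₂³B₆ + 3B₂²B₄² − 96B₄³ − 36B₆² + 36B₂B₄B₆)` when `b₂ = 3²B₂`, `b₄ = 3⁴B₄`,
`b₆ = 3⁵B₆` — the exit-IV polynomial shifted by `3⁶`. [folklore] -/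
private theorem four_Δ_of_b_nine_of_b₄ (W : WeierstrassCurve R) {B₂ B₄ B₆ : R}
    (hb₂ : W.b₂ = 3 ^ 2 * B₂) (hb₄ : W.b₄ = 3 ^ 4 * B₄) (hb₆ : W.b₆ = 3 ^ 5 * B₆) :
    4 * W.Δ = 3 ^ 11 * (-B₂ ^ 3 * B₆ + 3 * B₂ ^ 2 * B₄ ^ 2 - 96 * B₄ ^ 3 - 36 * B₆ ^ 2 +
      36 * B₂ * B₄ * B₆) := by
  rw [four_mul_Δ_eq, hb₂, hb₄, hb₆]; ring

/-- `𝔪 ^ n`-membership is divisibility by `3 ^ n` when `3` is a uniformiser. [folklore] -/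
private theorem mem_pow_iff_three_pow_dvd' (h3 : Irreducible (3 : R)) (x : R) (n : ℕ) :
    x ∈ maximalIdeal R ^ n ↔ (3 : R) ^ n ∣ x :=
  mem_maximalIdeal_pow_iff_dvd_of_irreducible h3 x n

/-- **Exit III* (Step 9) at `p = 3`: the exact invariants.** On a Step-9 normalised model
(`π ∣ a₁`, `π² ∣ a₂`, `π³ ∣ a₃, a₄`, `π⁵ ∣ a₆`; Silverman *ATAEC* IV.9.4) with `π⁴ ∤ a₄`
(type III*, `m = 8`), write `b₂ = 3²B₂`, `b₄ = 3³B₄`, `b₆ = 3⁴B₆`; then `B₄ ∈ Rˣ`, `3 ∣ B₆`,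
`ord Δ = 9`, and either `B₂ ∈ Rˣ`: `3⁴ ∣ c₄`, `ord c₆ = 6` (row `(≥4, 6, 9)` with the special
condition, `f = 2`) or `3 ∣ B₂`: `ord c₄ = 4`, `3⁸ ∣ c₆` (row `(4, ≥8, 9)`, `f = 2`).
[cite: Silverman1994, IV.9.4 Step 9 and Table 4.1] [cite: Rizzo2003, Table II (p. 4), rows III*] -/
theorem exitIIIstar_values (h2 : IsUnit (2 : R)) (h3 : Irreducible (3 : R))
    (W : WeierstrassCurve R) (ha₁ : W.a₁ ∈ maximalIdeal R) (ha₂ : W.a₂ ∈ maximalIdeal R ^ 2)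
    (ha₃ : W.a₃ ∈ maximalIdeal R ^ 3) (ha₄ : W.a₄ ∈ maximalIdeal R ^ 3)
    (ha₆ : W.a₆ ∈ maximalIdeal R ^ 5) (h9 : W.a₄ ∉ maximalIdeal R ^ 4) :
    ∃ B₂ B₄ B₆ : R, W.b₂ = 3 ^ 2 * B₂ ∧ W.b₄ = 3 ^ 3 * B₄ ∧ W.b₆ = 3 ^ 4 * B₆ ∧ IsUnit B₄ ∧
      (3 : R) ∣ B₆ ∧ (addVal R W.Δ).toNat = 9 ∧
      ((IsUnit B₂ ∧ (3 : R) ^ 4 ∣ W.c₄ ∧ (addVal R W.c₆).toNat = 6) ∨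
        (¬ IsUnit B₂ ∧ (addVal R W.c₄).toNat = 4 ∧ (3 : R) ^ 8 ∣ W.c₆)) := by
  have ha₁' := (mem_maximalIdeal_iff_dvd_of_irreducible h3 _).mp ha₁
  have ha₂' := (mem_pow_iff_three_pow_dvd' h3 _ _).mp ha₂
  have ha₃' := (mem_pow_iff_three_pow_dvd' h3 _ _).mp ha₃
  have ha₄' := (mem_pow_iff_three_pow_dvd' h3 _ _).mp ha₄
  have ha₆' := (mem_pow_iff_three_pow_dvd' h3 _ _).mp ha₆
  have h9' : ¬ (3 : R) ^ 4 ∣ W.a₄ := fun h => h9 ((mem_pow_iff_three_pow_dvd' h3 _ _).mpr h)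
  have hΔ9 := addVal_Δ_toNat_eq_nine_of_step9 h3 h2 W ha₁' ha₂' ha₃' ha₄' ha₆' h9'
  obtain ⟨α, hα⟩ := ha₁'
  obtain ⟨p, hp⟩ := ha₂'
  obtain ⟨γ, hγ⟩ := ha₃'
  obtain ⟨q, hq⟩ := ha₄'
  obtain ⟨r, hr⟩ := ha₆'
  have h8 : IsUnit (8 : R) := isUnit_eight'' h2
  have hα' : W.a₁ = 3 * α := by rw [hα]
  have hb₂ := b₂_step8 W 3 hα' hp
  have hb₄ := b₄_step9 W 3 hα' hγ hq
  have hb₆' := b₆_step9 W 3 hγ hr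
  have hb₆ : W.b₆ = 3 ^ 4 * (3 * (4 * r + 3 * γ ^ 2)) := by rw [hb₆']; ring
  have hqu : IsUnit q := by
    rw [isUnit_iff_not_dvd h3]
    intro hd; apply h9'; rw [hq, pow_succ]; exact mul_dvd_mul_left _ hd
  have hB₄ : IsUnit (2 * q + 3 * α * γ) := by
    have := isUnit_add_mul_of_isUnit h3 (h2.mul hqu) (α * γ)
    rwa [← mul_assoc] at this
  set B₂ : R := 4 * p + α ^ 2 with hB₂def
  set B₄ : R := 2 * q + 3 * α * γ with hB₄def
  have hc₄ : W.c₄ = 3 ^ 4 * (B₂ ^ 2 - 8 * B₄) := by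
    simp only [WeierstrassCurve.c₄]; rw [hb₂, hb₄]; ring
  have hc₆ : W.c₆ = 3 ^ 6 * (-B₂ ^ 3 + 12 * B₂ * B₄ - 24 * (3 * (4 * r + 3 * γ ^ 2))) := by
    simp only [WeierstrassCurve.c₆]; rw [hb₂, hb₄, hb₆]; ring
  refine ⟨B₂, B₄, 3 * (4 * r + 3 * γ ^ 2), hb₂, hb₄, hb₆, hB₄, dvd_mul_right 3 _, hΔ9, ?_⟩
  by_cases hB₂ : IsUnit B₂
  · refine Or.inl ⟨hB₂, ⟨B₂ ^ 2 - 8 * B₄, hc₄⟩, ?_⟩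
    have e : 1 * W.c₆ = 3 ^ 6 * (-B₂ ^ 3 + 3 * (4 * B₂ * B₄ - 24 * (4 * r + 3 * γ ^ 2))) := by
      rw [hc₆]; ring
    exact addVal_toNat_eq_of_eq_add h3 isUnit_one (hB₂.pow 3).neg e
  · obtain ⟨B₂', hB₂'⟩ := (not_isUnit_iff_dvd h3 _).mp hB₂
    refine Or.inr ⟨hB₂, ?_, ⟨-(3 * B₂' ^ 3) + 4 * B₂' * B₄ - 8 * (4 * r + 3 * γ ^ 2), ?_⟩⟩
    · have e : 1 * W.c₄ = 3 ^ 4 * (-(8 * B₄) + 3 * (3 * B₂' ^ 2)) := by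
        rw [hc₄, hB₂']; ring
      exact addVal_toNat_eq_of_eq_add h3 isUnit_one (h8.mul hB₄).neg e
    · rw [hc₆, hB₂']; ring

/-- **Exit II* (Step 10) at `p = 3`: the exact invariants.** On a Step-9 normalised model with
moreover `π⁴ ∣ a₄` and `π⁶ ∤ a₆` (Silverman *ATAEC* IV.9.4, Step 10 fires: type II*, `m = 9`),
write `b₂ = 3²B₂`; then `b₄ = 3⁴B₄`, `b₆ = 3⁵B₆` with `B₆ ∈ Rˣ`, and exactly one of:
`B₂ ∈ Rˣ`: `(ord c₄, ord c₆, ord Δ) = (4, 6, 11)` (`f = 3`); `3 ∣ B₂`, `B₄ ∈ Rˣ`: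
`(5, 8, 12)` (`f = 4`; reduced triple `(1,2,0)`★); `3 ∣ B₂, B₄`: `3⁶ ∣ c₄`, `ord c₆ = 8`,
`ord Δ = 13` (`f = 5`; reduced triple `(≥2,2,1)`★) — the exit-IV data shifted by `(2, 3, 6)`.
[cite: Silverman1994, IV.9.4 Step 10 and Table 4.1] [cite: Rizzo2003, Table II (p. 4), rows II*] -/
theorem exitIIstar_values (h2 : IsUnit (2 : R)) (h3 : Irreducible (3 : R))
    (W : WeierstrassCurve R) (ha₁ : W.a₁ ∈ maximalIdeal R) (ha₂ : W.a₂ ∈ maximalIdeal R ^ 2)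
    (ha₃ : W.a₃ ∈ maximalIdeal R ^ 3) (ha₄ : W.a₄ ∈ maximalIdeal R ^ 4)
    (ha₆ : W.a₆ ∈ maximalIdeal R ^ 5) (h10 : W.a₆ ∉ maximalIdeal R ^ 6) :
    ∃ B₂ B₄ B₆ : R, W.b₂ = 3 ^ 2 * B₂ ∧ W.b₄ = 3 ^ 4 * B₄ ∧ W.b₆ = 3 ^ 5 * B₆ ∧ IsUnit B₆ ∧
      ((IsUnit B₂ ∧ (addVal R W.c₄).toNat = 4 ∧ (addVal R W.c₆).toNat = 6 ∧
          (addVal R W.Δ).toNat = 11) ∨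
        (¬ IsUnit B₂ ∧ IsUnit B₄ ∧ (addVal R W.c₄).toNat = 5 ∧ (addVal R W.c₆).toNat = 8 ∧
          (addVal R W.Δ).toNat = 12) ∨
        (¬ IsUnit B₂ ∧ ¬ IsUnit B₄ ∧ (3 : R) ^ 6 ∣ W.c₄ ∧ (addVal R W.c₆).toNat = 8 ∧
          (addVal R W.Δ).toNat = 13)) := by
  obtain ⟨α, hα⟩ := (mem_maximalIdeal_iff_dvd_of_irreducible h3 _).mp ha₁
  obtain ⟨p, hp⟩ := (mem_pow_iff_three_pow_dvd' h3 _ _).mp ha₂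
  obtain ⟨γ, hγ⟩ := (mem_pow_iff_three_pow_dvd' h3 _ _).mp ha₃
  obtain ⟨q, hq⟩ := (mem_pow_iff_three_pow_dvd' h3 _ _).mp ha₄
  obtain ⟨r, hr⟩ := (mem_pow_iff_three_pow_dvd' h3 _ _).mp ha₆
  have h10' : ¬ (3 : R) ^ 6 ∣ W.a₆ := fun h => h10 ((mem_pow_iff_three_pow_dvd' h3 _ _).mpr h)
  have h4 : IsUnit (4 : R) := isUnit_four h2
  have h8 : IsUnit (8 : R) := isUnit_eight'' h2
  have h32 : IsUnit (32 : R) := isUnit_32 h2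
  have hα' : W.a₁ = 3 * α := by rw [hα]
  have hb₂ := b₂_step8 W 3 hα' hp
  have hb₄ := b₄_step10 W 3 hα' hγ hq
  have hb₆ := b₆_step9 W 3 hγ hr
  have hru : IsUnit r := by
    rw [isUnit_iff_not_dvd h3]
    intro hd; apply h10'; rw [hr, pow_succ]; exact mul_dvd_mul_left _ hd
  have hB₆ : IsUnit (4 * r + 3 * γ ^ 2) := isUnit_add_mul_of_isUnit h3 (h4.mul hru) _
  set B₂ : R := 4 * p + α ^ 2 with hB₂def
  set B₄ : R := 2 * q + α * γ with hB₄def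
  set B₆ : R := 4 * r + 3 * γ ^ 2 with hB₆def
  have hc₄ := c₄_of_b_nine_of_b₄ W hb₂ hb₄
  have hc₆ := c₆_of_b_nine_of_b₄ W hb₂ hb₄ hb₆
  have hΔ := four_Δ_of_b_nine_of_b₄ W hb₂ hb₄ hb₆
  refine ⟨B₂, B₄, B₆, hb₂, hb₄, hb₆, hB₆, ?_⟩
  by_cases hB₂ : IsUnit B₂
  · -- row (4, 6, 11)
    refine Or.inl ⟨hB₂, ?_, ?_, ?_⟩
    · have e : 1 * W.c₄ = 3 ^ 4 * (B₂ ^ 2 + 3 * (-(8 * B₄))) := by rw [hc₄]; ring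
      exact addVal_toNat_eq_of_eq_add h3 isUnit_one (hB₂.pow 2) e
    · have e : 1 * W.c₆ = 3 ^ 6 * (-B₂ ^ 3 + 3 * (12 * B₂ * B₄ - 24 * B₆)) := by rw [hc₆]; ring
      exact addVal_toNat_eq_of_eq_add h3 isUnit_one (hB₂.pow 3).neg e
    · have e : 4 * W.Δ = 3 ^ 11 * (-B₂ ^ 3 * B₆ +
          3 * (B₂ ^ 2 * B₄ ^ 2 - 32 * B₄ ^ 3 - 12 * B₆ ^ 2 + 12 * B₂ * B₄ * B₆)) := by
        rw [hΔ]; ring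
      exact addVal_toNat_eq_of_eq_add h3 h4 ((hB₂.pow 3).neg.mul hB₆) e
  obtain ⟨B₂', hB₂'⟩ := (not_isUnit_iff_dvd h3 _).mp hB₂
  have hc₆8 : (addVal R W.c₆).toNat = 8 := by
    have e : 1 * W.c₆ = 3 ^ 8 * (-(8 * B₆) + 3 * (-B₂' ^ 3 + 4 * B₂' * B₄)) := by
      rw [hc₆, hB₂']; ring
    exact addVal_toNat_eq_of_eq_add h3 isUnit_one (h8.mul hB₆).neg e
  by_cases hB₄u : IsUnit B₄
  · -- row (5, 8, 12): reduced triple (1, 2, 0)★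
    refine Or.inr (Or.inl ⟨hB₂, hB₄u, ?_, hc₆8, ?_⟩)
    · have e : 1 * W.c₄ = 3 ^ 5 * (-(8 * B₄) + 3 * B₂' ^ 2) := by rw [hc₄, hB₂']; ring
      exact addVal_toNat_eq_of_eq_add h3 isUnit_one (h8.mul hB₄u).neg e
    · have e : 4 * W.Δ = 3 ^ 12 * (-32 * B₄ ^ 3 +
          3 * (-(3 * B₂' ^ 3) * B₆ + 3 * B₂' ^ 2 * B₄ ^ 2 - 4 * B₆ ^ 2 + 12 * B₂' * B₄ * B₆)) := by
        rw [hΔ, hB₂']; ring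
      exact addVal_toNat_eq_of_eq_add h3 h4 (h32.neg.mul (hB₄u.pow 3)) e
  · -- row (≥6, 8, 13): reduced triple (≥2, 2, 1)★
    obtain ⟨B₄', hB₄'⟩ := (not_isUnit_iff_dvd h3 _).mp hB₄u
    refine Or.inr (Or.inr ⟨hB₂, hB₄u, ⟨B₂' ^ 2 - 8 * B₄', ?_⟩, hc₆8, ?_⟩)
    · rw [hc₄, hB₂', hB₄']; ring
    · have e : 4 * W.Δ = 3 ^ 13 * (-(4 * B₆ ^ 2) +
          3 * (-(96 * B₄' ^ 3) - B₂' ^ 3 * B₆ + 9 * B₂' ^ 2 * B₄' ^ 2 + 12 * B₂' * B₄' * B₆)) := by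
        rw [hΔ, hB₂', hB₄']; ring
      exact addVal_toNat_eq_of_eq_add h3 h4 (h4.mul (hB₆.pow 2)).neg e

/-! ### Steps 1 and 2: good and multiplicative reduction -/

/-- **Good reduction at `p = 3`: the invariants.** If `3 ∤ Δ` then either `3 ∤ c₄, c₆` (row
`(0,0,0)`) or `ord c₄ = 1`, `27 ∣ c₆` (row `(1, ≥3, 0)`): `3 ∣ c₄ = b₂² − 24b₄` forces `3 ∣ b₂`,
whence `27 ∣ c₆ = −b₂³ + 36b₂b₄ − 216b₆`, and `1728Δ = c₄³ − c₆²` with `ord (1728Δ) = 3` forces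
`ord c₄ = 1`. [cite: Rizzo2003, Table II (p. 4), rows I₀] -/
theorem good_values (h2 : IsUnit (2 : R)) (h3 : Irreducible (3 : R)) (W : WeierstrassCurve R)
    (hΔ : ¬ (3 : R) ∣ W.Δ) :
    (¬ (3 : R) ∣ W.c₄ ∧ ¬ (3 : R) ∣ W.c₆) ∨
      ((addVal R W.c₄).toNat = 1 ∧ (3 : R) ^ 3 ∣ W.c₆) := by
  have hp := h3.prime
  by_cases hc₄ : (3 : R) ∣ W.c₄
  · right
    have hb₂ : (3 : R) ∣ W.b₂ := by
      have e : W.b₂ ^ 2 = W.c₄ + 24 * W.b₄ := by simp only [WeierstrassCurve.c₄]; ring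
      exact hp.dvd_of_dvd_pow (n := 2) (by rw [e]; exact dvd_add hc₄ ⟨8 * W.b₄, by ring⟩)
    obtain ⟨β, hβ⟩ := hb₂
    have hc₆ : W.c₆ = 3 ^ 3 * (-β ^ 3 + 4 * β * W.b₄ - 8 * W.b₆) := by
      simp only [WeierstrassCurve.c₆]; rw [hβ]; ring
    refine ⟨?_, ⟨_, hc₆⟩⟩
    -- `c₄ = 3t` with `t³ = 64 Δ + 27 C₆²`, so `t` is a unit and `ord c₄ = 1`
    obtain ⟨t, ht⟩ := hc₄
    have h64 : IsUnit (64 : R) := by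
      have : (64 : R) = 2 ^ 6 := by norm_num
      rw [this]; exact h2.pow 6
    have h27 : (27 : R) ≠ 0 := by
      have : (27 : R) = 3 ^ 3 := by norm_num
      rw [this]; exact pow_ne_zero 3 h3.ne_zero
    have ht3 : t ^ 3 = 64 * W.Δ + 27 * (-β ^ 3 + 4 * β * W.b₄ - 8 * W.b₆) ^ 2 := by
      have hrel := W.c_relation
      rw [hc₆, ht] at hrel
      apply mul_left_cancel₀ h27
      linear_combination -hrel
    have htu : IsUnit t := by
      rw [isUnit_iff_not_dvd h3]
      intro hd
      apply hΔ
      have h1 : (3 : R) ∣ 64 * W.Δ := by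
        have h2' : (3 : R) ∣ t ^ 3 := dvd_pow hd three_ne_zero
        rw [ht3] at h2'
        exact (dvd_add_left ⟨9 * (-β ^ 3 + 4 * β * W.b₄ - 8 * W.b₆) ^ 2, by ring⟩).mp h2'
      exact (h64.dvd_mul_left).mp h1
    exact addVal_toNat_eq_of_eq h3 isUnit_one htu (show 1 * W.c₄ = 3 ^ 1 * t by rw [ht]; ring)
  · left
    refine ⟨hc₄, fun hc₆ => hc₄ ?_⟩
    have e : W.c₄ ^ 3 = 1728 * W.Δ + W.c₆ ^ 2 := by linear_combination -W.c_relation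
    exact hp.dvd_of_dvd_pow (n := 3)
      (by rw [e]; exact dvd_add ⟨576 * W.Δ, by ring⟩ (dvd_pow hc₆ two_ne_zero))

/-- **Multiplicative reduction at `p = 3`: the invariants.** If `3 ∣ Δ` and `3 ∤ c₄` then
`3 ∤ c₆` (row `(0, 0, n)`, `n = ord Δ`). [cite: Rizzo2003, Table II (p. 4), row Iₙ] -/
theorem multiplicative_values (h3 : Irreducible (3 : R)) (W : WeierstrassCurve R)
    (hΔ : (3 : R) ∣ W.Δ) (hc₄ : ¬ (3 : R) ∣ W.c₄) : ¬ (3 : R) ∣ W.c₆ := by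
  intro hc₆
  apply hc₄
  have e : W.c₄ ^ 3 = 1728 * W.Δ + W.c₆ ^ 2 := by linear_combination -W.c_relation
  exact h3.prime.dvd_of_dvd_pow (n := 3)
    (by rw [e]; exact dvd_add (dvd_mul_of_dvd_right hΔ _) (dvd_pow hc₆ two_ne_zero))


end TateAlgorithm

end Literature.NumberTheory.DiophantineGeometry
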